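import Literature.MathematicalPhysics.QuantumFieldTheory.Balaban1983to89.B9Delta2FormMajorant

/-!
# `Balaban1983to89.B9Delta2FormMajorantOf149` — [B9] p. 423 after (3.137) («the supremum |A| is taken over several j-blocks surrounding Δ(y)») FROM
# [5] (149) + [5] p. 24 LOCALITY ∕ [B11] (56) SYMMETRY: the three-point block letter `C2FormMaj` of the N06 certificate for [5]'s polarised second-order
# form `C⁽²⁾(U; A, A′)` is IMPLIED by print's (149)-shaped per-entry bound — the socket of the junction N04 → N06 for the displayed letter `hC2`

T. Bałaban, *Propagators for lattice gauge theories in a background field*, Commun. Math. Phys. **99** (1985) 389–434 [`Balaban1985BackgroundPropagators`,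
"B9"]; [5] = T. Bałaban, *Averaging operations for lattice gauge theories*, Commun. Math. Phys. **98** (1985) 17–51 [`Balaban1985Averaging`, "B7"]; [B11] =
T. Bałaban, *The variational problem and background fields in renormalization group method for lattice gauge theories*, Commun. Math. Phys. **102** (1985)
277–309 [`Balaban1985Variational`].
statement-level skeleton of published theorems with citation tags; proofs where landed; nothing here is a claim about the Yang–Mills mass gap.

THE PRINT.  [5] p. 40, (149): *"|⟨(δ∕δA)C_j(U₀, A), δA⟩| ≦ C₃|A|Q″_j|δA|"*, with (141) p. 39 *"(Q″_kA)_c = Σ_{b⊂Bᵏ(c₋)∪Bᵏ(c₊)} η^dA_b"* — the pairing of the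
functional derivative with a variation `δA` is bounded by the SUP of `A` times the box average of `|δA|` over the two blocks adjacent to the coarse bond `c`;
[5] p. 24: *"this definition is local in the sense that Ū^k_c, c ⊂ Ω^{(k)}, depends only on the bond variables U_b for b ⊂ B^k(c₋) ∪ B^k(c₊)"* — so
`C_j(U₀, A)(c)` (a function of the `U_b e^{…A_b}`) depends only on `A` in that box; [B11] p. 286 after (56): *"C_j⁽²⁾(A′, A″) denotes a symmetric bilinear
form obtained by polarization from the quadratic form C⁽²⁾(A′)"*; [B9] p. 423 after (3.137): *"and the supremum |A| is taken over several j-blocks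
surrounding Δ(y)"*.

THE POINT (seat dag-n06-l g34, LOCATED-C2, cell bus I.32852).  After the N06 certificate edition «VO» the rows-20∕21 cone displays, besides O5's `hZ`, exactly
ONE letter schema: `hC2 : … → C2FormMaj x.toKIdx (bI x) id (𝔠 x).form U κ_C δ_C (len·n⁻¹)` (n06-w8's `B9Delta2FormMajorant.C2FormMaj`: for `A` supported in
the fine block of `y′` and bounded by `B` there, a test delta `δ_z ⊗ a` and a coarse bond `c`, `‖C⁽²⁾(U; A, δ_z ⊗ a)(c)‖ ≦ κ_C·w_C(c)·e^{−δ_C d(c, y(z))}·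
e^{−δ_C d(c, y′)}·B·‖a‖`) — a THREE-POINT block majorant, the shape the (3.137) producer `hasMajorant_coordOpK_delta2OfY` consumes.  The junction from [5]
(N04) will deliver (149) in ITS printed shape: per entry, `‖C⁽²⁾(U; A, δ_z ⊗ a)(c)‖ ≦ K(c)·‖A‖_∞·q(c, z)·‖a‖` with a BOX KERNEL `q(c, z) ≧ 0` that vanishes
unless the block of `z` is one of the blocks adjacent to `c` (within radius `r` of `c` in the [B9] geometry) and is `≦ q₀(c)` there (on `ℤᵈ`:
`B7Eq136SecondOrder.ineq149_secondOrder`, `q = kerQdd = L^{−jd}𝟙[z ⊂ Bʲ(c₋)∪Bʲ(c₊)]`, `K = C₃(Lʲ)²`; on a torus the image count of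
`B7Eq141TorusImagesCount` multiplies `q₀` by `≦ 2ᵈ`).  THIS FILE is the bookkeeping between the two shapes, for ANY form `C`, ANY `U`, ANY geometry and
block maps: the (149) shape gives locality in the VARIATION; locality in the block-supported argument `A` comes EITHER from [5] p. 24 (the first-argument
locality of `C(U; ·, A′)(c)`, hypothesis `hloc`) OR — with no locality hypothesis at all — from the SYMMETRY of the polarisation ([B11] (56); def-Y's
`C2LettersY.symm`): `C(U; A, δ_z ⊗ a)(c) = Σ_w C(U; δ_z ⊗ a, δ_w ⊗ A_w)(c)` and each term is killed by (149) when the block of `w` (= `y′`) is far from `c`.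
In the near case both exponentials are `≧ e^{−δ_C r}`, so the budget `K(c)·q₀(c)·e^{2δ_C r} ≦ κ_C·w_C(c)` closes the letter at ANY rate `δ_C ≧ 0`.

WHAT THIS FILE PROVES (theorems only; 0 sorry; standard axioms).
* §1 `eq_sum_deltaY` (`A = Σ_w δ_w ⊗ A(w)`), `apply_eq_sum_deltaY_right` (linearity in the second argument along that decomposition),
  `norm_le_of_blockSupported` (`‖A‖_∞ ≦ B` for a block-supported `A`), `norm_deltaY_le` (`‖δ_z ⊗ a‖_∞ ≦ ‖a‖`).
* §2 (for the applied form `P = C(U)`) the VANISHING lemmas under the (149) shape: `apply_deltaY_eq_zero_of_far` (far variation bond ⇒ the entry is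
  `0`), `apply_eq_zero_of_symm_of_far_support` (symmetric `P`, support block of `A` far from `c` ⇒ the entry is `0`), `apply_eq_zero_of_local_of_far_support`
  (the same from first-argument locality).
* §3 `near_budget`, `rhs_nonneg` (arithmetic), ★★ `c2FormMaj_of_ineq149_symm` and ★ `c2FormMaj_of_ineq149_local`: (149)-shape + box-kernel data + budget
  ⟹ `C2FormMaj i σ σI C U κ_C δ_C w_C`.
NOT CLAIMED: the inhabitant (the torus reading of [5]'s `C_j⁽²⁾` on def-Y's carriers — the junction's object, separate files); any statement about `Δ⁽²⁾`.
-/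

noncomputable section

open scoped BigOperators

namespace Literature.MathematicalPhysics.QuantumFieldTheory.Balaban1983to89.B9Delta2FormMajorantOf149

open Node00 (CfgY FBondY IBondY deltaY)
open B6KLevelCensusIndexV1 (KIdx)
open B9Delta2FormMajorant (C2FormMaj)

variable {d ℓ : ℕ} {hd : 1 ≤ d + 1} {hL : Odd (ℓ + 1) ∧ 1 < ℓ + 1} {b₀ b₁ : ℝ}
variable {𝔸 : Type} [NormedRing 𝔸] [NormedAlgebra ℂ 𝔸]

/-! ## §1 Bookkeeping: the single-bond decomposition and the sup norm of block-supported fields -/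

section Bookkeeping

omit [NormedAlgebra ℂ 𝔸] in
open Classical in
/-- `A = Σ_w δ_w ⊗ A(w)` — a bond field is the sum of its single-bond pieces. [cite: Balaban1985Averaging, (137)–(138) p.39 (the pairing bond by bond), bookkeeping] -/
theorem eq_sum_deltaY {X : Type} [Fintype X] (A : X → 𝔸) : A = ∑ w, deltaY w (A w) := by
  funext z
  rw [Finset.sum_apply]
  simp only [deltaY]
  rw [Finset.sum_ite_eq]
  simp

omit [NormedAlgebra ℂ 𝔸] in
open Classical in
/-- `‖δ_z ⊗ a‖_∞ ≤ ‖a‖`. [cite: Balaban1985BackgroundPropagators, (3.48) p.398 (kernel entries), bookkeeping] -/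
theorem norm_deltaY_le {X : Type} [Fintype X] (z : X) (a : 𝔸) : ‖deltaY z a‖ ≤ ‖a‖ := by
  refine (pi_norm_le_iff_of_nonneg (norm_nonneg a)).2 fun w => ?_
  simp only [deltaY]
  split_ifs
  · exact le_rfl
  · rw [norm_zero]; exact norm_nonneg a

omit [NormedAlgebra ℂ 𝔸] in
/-- `‖A‖_∞ ≤ B` for a field supported in the block of `y′` and bounded by `B ≥ 0` there. [cite: Balaban1985BackgroundPropagators, p.423 after (3.137) («the supremum |A|»), bookkeeping] -/
theorem norm_le_of_blockSupported {X S : Type} [Fintype X] (σ : X → S) (y' : S) (A : X → 𝔸) {B : ℝ} (hB : 0 ≤ B)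
    (hAb : ∀ w, σ w = y' → ‖A w‖ ≤ B) (hA0 : ∀ w, σ w ≠ y' → A w = 0) : ‖A‖ ≤ B := by
  refine (pi_norm_le_iff_of_nonneg hB).2 fun w => ?_
  by_cases hw : σ w = y'
  · exact hAb w hw
  · rw [hA0 w hw, norm_zero]; exact hB

variable (i : KIdx d ℓ hd hL b₀ b₁)

/-- linearity of the polarised form in its second argument along the single-bond decomposition:
`C(U; A′, A)(c) = Σ_w C(U; A′, δ_w ⊗ A(w))(c)`. [cite: Balaban1985Variational, (56) p.286 (bilinear form), bookkeeping] -/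
theorem apply_eq_sum_deltaY_right (P : (FBondY i → 𝔸) →ₗ[ℂ] (FBondY i → 𝔸) →ₗ[ℂ] (IBondY i → 𝔸))
    (A' A : FBondY i → 𝔸) (c : IBondY i) : P A' A c = ∑ w, P A' (deltaY w (A w)) c := by
  conv_lhs => rw [eq_sum_deltaY A]
  rw [map_sum, Finset.sum_apply]

end Bookkeeping

/-! ## §2 The two vanishing lemmas under the (149) shape -/

section Vanishing

variable (i : KIdx d ℓ hd hL b₀ b₁) {g : B9.Geometry}
variable (σ : FBondY i → g.Site) (σI : IBondY i → g.Site)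
  (P : (FBondY i → 𝔸) →ₗ[ℂ] (FBondY i → 𝔸) →ₗ[ℂ] (IBondY i → 𝔸))
  {q : IBondY i → FBondY i → ℝ} {K : IBondY i → ℝ} {r : ℝ}

/-- **FAR VARIATION BOND ⇒ THE ENTRY VANISHES**: under the (149) shape `‖C(U; A, δ_z ⊗ a)(c)‖ ≤ K(c)‖A‖q(c,z)‖a‖` with a box kernel vanishing beyond radius
`r` from `c`, `C(U; A, δ_z ⊗ a)(c) = 0` whenever the block of `z` is farther than `r` from `c` ((141): `Q″_j` only sees `Bʲ(c₋)∪Bʲ(c₊)`).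
[cite: Balaban1985Averaging, (149) p.40, (141) p.39] -/
theorem apply_deltaY_eq_zero_of_far
    (h149 : ∀ (A : FBondY i → 𝔸) (z : FBondY i) (a : 𝔸) (c : IBondY i), ‖P A (deltaY z a) c‖ ≤ K c * ‖A‖ * q c z * ‖a‖)
    (hqloc : ∀ c z, r < g.dist (σI c) (σ z) → q c z = 0)
    (A : FBondY i → 𝔸) {z : FBondY i} (a : 𝔸) {c : IBondY i} (hfar : r < g.dist (σI c) (σ z)) : P A (deltaY z a) c = 0 := by
  have h := h149 A z a c
  rw [hqloc c z hfar, mul_zero, zero_mul] at h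
  exact norm_le_zero_iff.1 h

/-- **SYMMETRIC FORM, SUPPORT BLOCK OF `A` FAR FROM `c` ⇒ THE ENTRY VANISHES** — locality in the block-supported argument WITHOUT a locality hypothesis:
`C(U; A, δ_z ⊗ a)(c) = C(U; δ_z ⊗ a, A)(c) = Σ_w C(U; δ_z ⊗ a, δ_w ⊗ A(w))(c)`, and every term vanishes — by (149) when `σ w = y′` is far from `c`, by
`A(w) = 0` otherwise. [cite: Balaban1985Variational, (56) p.286] [cite: Balaban1985Averaging, (149) p.40, (141) p.39]
[cite: Balaban1985BackgroundPropagators, p.423 after (3.137)] -/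
theorem apply_eq_zero_of_symm_of_far_support (hsymm : ∀ A A', P A A' = P A' A)
    (h149 : ∀ (A : FBondY i → 𝔸) (z : FBondY i) (a : 𝔸) (c : IBondY i), ‖P A (deltaY z a) c‖ ≤ K c * ‖A‖ * q c z * ‖a‖)
    (hqloc : ∀ c z, r < g.dist (σI c) (σ z) → q c z = 0)
    {y' : g.Site} (A : FBondY i → 𝔸) (hA0 : ∀ w, σ w ≠ y' → A w = 0) (A' : FBondY i → 𝔸) {c : IBondY i}
    (hfar : r < g.dist (σI c) y') : P A A' c = 0 := by
  rw [hsymm A A', apply_eq_sum_deltaY_right i P A' A c]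
  refine Finset.sum_eq_zero fun w _ => ?_
  by_cases hw : σ w = y'
  · exact apply_deltaY_eq_zero_of_far i σ σI P h149 hqloc A' (A w) (by rw [hw]; exact hfar)
  · rw [hA0 w hw]
    have h0 : deltaY (𝔸 := 𝔸) w (0 : 𝔸) = 0 := by
      funext z'; simp [deltaY]
    rw [h0, map_zero, Pi.zero_apply]

/-- **FIRST-ARGUMENT LOCALITY, SUPPORT BLOCK OF `A` FAR FROM `c` ⇒ THE ENTRY VANISHES** ([5] p. 24: `C_j(U₀, ·)(c)` depends only on the bonds of
`Bʲ(c₋)∪Bʲ(c₊)`): if `C(U; ·, A′)(c)` only reads `A` on bonds whose block is within `r` of `c`, then a field supported in a farther block gives `0`.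
[cite: Balaban1985Averaging, p.24 (locality), (149) p.40] [cite: Balaban1985BackgroundPropagators, p.423 after (3.137)] -/
theorem apply_eq_zero_of_local_of_far_support
    (hloc : ∀ (A₁ A₂ A' : FBondY i → 𝔸) (c : IBondY i), (∀ w, g.dist (σI c) (σ w) ≤ r → A₁ w = A₂ w) → P A₁ A' c = P A₂ A' c)
    {y' : g.Site} (A : FBondY i → 𝔸) (hA0 : ∀ w, σ w ≠ y' → A w = 0) (A' : FBondY i → 𝔸) {c : IBondY i}
    (hfar : r < g.dist (σI c) y') : P A A' c = 0 := by
  have h : P A A' c = P 0 A' c := by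
    refine hloc A 0 A' c fun w hw => ?_
    have hne : σ w ≠ y' := fun h => by rw [h] at hw; exact absurd hw (not_le.2 hfar)
    rw [hA0 w hne, Pi.zero_apply]
  rw [h, map_zero, LinearMap.zero_apply, Pi.zero_apply]

end Vanishing

/-! ## §3 The letter `C2FormMaj` from the (149) shape -/

section Letter

variable [CompleteSpace 𝔸]
variable (i : KIdx d ℓ hd hL b₀ b₁) {g : B9.Geometry}
variable (σ : FBondY i → g.Site) (σI : IBondY i → g.Site)
  (C : CfgY 𝔸 i → (FBondY i → 𝔸) →ₗ[ℂ] (FBondY i → 𝔸) →ₗ[ℂ] (IBondY i → 𝔸)) (U : CfgY 𝔸 i)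
  {q : IBondY i → FBondY i → ℝ} {K q₀ : IBondY i → ℝ} {r κC δC : ℝ} {wC : g.Site → ℝ}

/-- the near-case arithmetic: with both distances `≤ r`, `δ_C ≥ 0` and the budget `K·q₀·e^{2δ_C r} ≤ κ_C·w_C`,
`K·B·q₀·‖a‖ ≤ κ_C·w_C·e^{−δ_C d₁}·e^{−δ_C d₂}·B·‖a‖`. [cite: Balaban1984PropagatorsII, (2.51) p.232 (block majorants), bookkeeping] -/
theorem near_budget {Kc q₀c wCc d₁ d₂ B na : ℝ} (hK : 0 ≤ Kc) (hq₀ : 0 ≤ q₀c) (hB : 0 ≤ B) (hna : 0 ≤ na) (hδC : 0 ≤ δC)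
    (hd₁ : d₁ ≤ r) (hd₂ : d₂ ≤ r) (hbudget : Kc * q₀c * Real.exp (2 * δC * r) ≤ κC * wCc) :
    Kc * B * q₀c * na ≤ κC * wCc * Real.exp (-(δC * d₁)) * Real.exp (-(δC * d₂)) * B * na := by
  have hE : Real.exp (2 * δC * r) * (Real.exp (-(δC * d₁)) * Real.exp (-(δC * d₂))) ≥ 1 := by
    rw [← Real.exp_add, ← Real.exp_add]
    refine Real.one_le_exp ?_
    nlinarith [mul_le_mul_of_nonneg_left hd₁ hδC, mul_le_mul_of_nonneg_left hd₂ hδC]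
  have hpos : 0 ≤ Real.exp (-(δC * d₁)) * Real.exp (-(δC * d₂)) := mul_nonneg (Real.exp_pos _).le (Real.exp_pos _).le
  have h1 : Kc * q₀c ≤ Kc * q₀c * (Real.exp (2 * δC * r) * (Real.exp (-(δC * d₁)) * Real.exp (-(δC * d₂)))) :=
    le_mul_of_one_le_right (mul_nonneg hK hq₀) hE
  have h2 : Kc * q₀c * (Real.exp (2 * δC * r) * (Real.exp (-(δC * d₁)) * Real.exp (-(δC * d₂)))) ≤
      κC * wCc * (Real.exp (-(δC * d₁)) * Real.exp (-(δC * d₂))) := by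
    rw [← mul_assoc]
    exact mul_le_mul_of_nonneg_right hbudget hpos
  have h3 : Kc * q₀c ≤ κC * wCc * (Real.exp (-(δC * d₁)) * Real.exp (-(δC * d₂))) := h1.trans h2
  have h4 := mul_le_mul_of_nonneg_right (mul_le_mul_of_nonneg_right h3 hB) hna
  calc Kc * B * q₀c * na = Kc * q₀c * B * na := by ring
    _ ≤ κC * wCc * (Real.exp (-(δC * d₁)) * Real.exp (-(δC * d₂))) * B * na := h4
    _ = κC * wCc * Real.exp (-(δC * d₁)) * Real.exp (-(δC * d₂)) * B * na := by ring

/-- the right-hand side of the letter is non-negative once the budget holds (`K, q₀ ≥ 0` force `κ_C·w_C(c) ≥ 0`). [cite: Balaban1984PropagatorsII, (2.51) p.232, bookkeeping] -/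
theorem rhs_nonneg {Kc q₀c wCc e₁ e₂ B na : ℝ} (hK : 0 ≤ Kc) (hq₀ : 0 ≤ q₀c) (hB : 0 ≤ B) (hna : 0 ≤ na)
    (hbudget : Kc * q₀c * Real.exp (2 * δC * r) ≤ κC * wCc) :
    0 ≤ κC * wCc * Real.exp e₁ * Real.exp e₂ * B * na := by
  have h0 : 0 ≤ κC * wCc := le_trans (mul_nonneg (mul_nonneg hK hq₀) (Real.exp_pos _).le) hbudget
  have := Real.exp_pos e₁
  have := Real.exp_pos e₂
  positivity

/-- ★★ **`C2FormMaj` FROM THE (149) SHAPE AND THE SYMMETRY OF THE POLARISATION.**  Let the polarised form satisfy, per entry, print's (149) shape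
`‖C(U; A, δ_z ⊗ a)(c)‖ ≤ K(c)·‖A‖_∞·q(c, z)·‖a‖` with a box kernel `q ≥ 0` vanishing when the block of `z` is farther than `r` from `c` and `≤ q₀(c)`, and
let `C(U)` be symmetric ([B11] (56)).  Then for every rate `δ_C ≥ 0` and every weight with `K(c)·q₀(c)·e^{2δ_C r} ≤ κ_C·w_C(σI c)`, the N06 letter
`C2FormMaj i σ σI C U κ_C δ_C w_C` holds: if either the block of `z` or the support block `y′` of `A` is farther than `r` from `c` the entry VANISHES (§2);
otherwise both exponentials are `≥ e^{−δ_C r}` and (149) with `‖A‖_∞ ≤ B` closes. [cite: Balaban1985Averaging, (149) p.40, (141) p.39]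
[cite: Balaban1985Variational, (56) p.286] [cite: Balaban1985BackgroundPropagators, (3.136)–(3.137) pp.422–423] -/
theorem c2FormMaj_of_ineq149_symm (hsymm : ∀ A A', C U A A' = C U A' A)
    (h149 : ∀ (A : FBondY i → 𝔸) (z : FBondY i) (a : 𝔸) (c : IBondY i), ‖C U A (deltaY z a) c‖ ≤ K c * ‖A‖ * q c z * ‖a‖)
    (hK : ∀ c, 0 ≤ K c) (hq : ∀ c z, 0 ≤ q c z) (hqloc : ∀ c z, r < g.dist (σI c) (σ z) → q c z = 0) (hq₀ : ∀ c z, q c z ≤ q₀ c)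
    (hδC : 0 ≤ δC) (hbudget : ∀ c, K c * q₀ c * Real.exp (2 * δC * r) ≤ κC * wC (σI c)) :
    C2FormMaj i σ σI C U κC δC wC := by
  intro y' A B hB hAb hA0 z a c
  have hq₀c : 0 ≤ q₀ c := (hq c z).trans (hq₀ c z)
  by_cases hz : r < g.dist (σI c) (σ z)
  · rw [apply_deltaY_eq_zero_of_far i σ σI (C U) h149 hqloc A a hz, norm_zero]
    exact rhs_nonneg (hK c) hq₀c hB (norm_nonneg a) (hbudget c)
  · by_cases hy : r < g.dist (σI c) y'
    · rw [apply_eq_zero_of_symm_of_far_support i σ σI (C U) hsymm h149 hqloc A hA0 (deltaY z a) hy, norm_zero]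
      exact rhs_nonneg (hK c) hq₀c hB (norm_nonneg a) (hbudget c)
    · have hA : ‖A‖ ≤ B := norm_le_of_blockSupported σ y' A hB hAb hA0
      calc ‖C U A (deltaY z a) c‖ ≤ K c * ‖A‖ * q c z * ‖a‖ := h149 A z a c
        _ ≤ K c * B * q₀ c * ‖a‖ := by
            have h1 : K c * ‖A‖ ≤ K c * B := mul_le_mul_of_nonneg_left hA (hK c)
            have h2 : K c * ‖A‖ * q c z ≤ K c * B * q₀ c :=
              mul_le_mul h1 (hq₀ c z) (hq c z) (mul_nonneg (hK c) hB)
            exact mul_le_mul_of_nonneg_right h2 (norm_nonneg a)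
        _ ≤ κC * wC (σI c) * Real.exp (-(δC * g.dist (σI c) (σ z))) * Real.exp (-(δC * g.dist (σI c) y')) * B * ‖a‖ :=
            near_budget (hK c) hq₀c hB (norm_nonneg a) hδC (not_lt.1 hz) (not_lt.1 hy) (hbudget c)

/-- ★ **`C2FormMaj` FROM THE (149) SHAPE AND [5] p. 24's FIRST-ARGUMENT LOCALITY** (no symmetry used): as `c2FormMaj_of_ineq149_symm`, with the support
locality supplied by the hypothesis that `C(U; ·, A′)(c)` reads `A` only on the bonds whose block is within `r` of `c`.
[cite: Balaban1985Averaging, (149) p.40, (141) p.39, p.24 (locality)] [cite: Balaban1985BackgroundPropagators, (3.136)–(3.137) pp.422–423] -/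
theorem c2FormMaj_of_ineq149_local
    (hloc : ∀ (A₁ A₂ A' : FBondY i → 𝔸) (c : IBondY i), (∀ w, g.dist (σI c) (σ w) ≤ r → A₁ w = A₂ w) → C U A₁ A' c = C U A₂ A' c)
    (h149 : ∀ (A : FBondY i → 𝔸) (z : FBondY i) (a : 𝔸) (c : IBondY i), ‖C U A (deltaY z a) c‖ ≤ K c * ‖A‖ * q c z * ‖a‖)
    (hK : ∀ c, 0 ≤ K c) (hq : ∀ c z, 0 ≤ q c z) (hqloc : ∀ c z, r < g.dist (σI c) (σ z) → q c z = 0) (hq₀ : ∀ c z, q c z ≤ q₀ c)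
    (hδC : 0 ≤ δC) (hbudget : ∀ c, K c * q₀ c * Real.exp (2 * δC * r) ≤ κC * wC (σI c)) :
    C2FormMaj i σ σI C U κC δC wC := by
  intro y' A B hB hAb hA0 z a c
  have hq₀c : 0 ≤ q₀ c := (hq c z).trans (hq₀ c z)
  by_cases hz : r < g.dist (σI c) (σ z)
  · rw [apply_deltaY_eq_zero_of_far i σ σI (C U) h149 hqloc A a hz, norm_zero]
    exact rhs_nonneg (hK c) hq₀c hB (norm_nonneg a) (hbudget c)
  · by_cases hy : r < g.dist (σI c) y'
    · rw [apply_eq_zero_of_local_of_far_support i σ σI (C U) hloc A hA0 (deltaY z a) hy, norm_zero]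
      exact rhs_nonneg (hK c) hq₀c hB (norm_nonneg a) (hbudget c)
    · have hA : ‖A‖ ≤ B := norm_le_of_blockSupported σ y' A hB hAb hA0
      calc ‖C U A (deltaY z a) c‖ ≤ K c * ‖A‖ * q c z * ‖a‖ := h149 A z a c
        _ ≤ K c * B * q₀ c * ‖a‖ := by
            have h1 : K c * ‖A‖ ≤ K c * B := mul_le_mul_of_nonneg_left hA (hK c)
            have h2 : K c * ‖A‖ * q c z ≤ K c * B * q₀ c :=
              mul_le_mul h1 (hq₀ c z) (hq c z) (mul_nonneg (hK c) hB)
            exact mul_le_mul_of_nonneg_right h2 (norm_nonneg a)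
        _ ≤ κC * wC (σI c) * Real.exp (-(δC * g.dist (σI c) (σ z))) * Real.exp (-(δC * g.dist (σI c) y')) * B * ‖a‖ :=
            near_budget (hK c) hq₀c hB (norm_nonneg a) hδC (not_lt.1 hz) (not_lt.1 hy) (hbudget c)

end Letter

end Literature.MathematicalPhysics.QuantumFieldTheory.Balaban1983to89.B9Delta2FormMajorantOf149
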